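import Literature.Barriers.AtomisticToContinuum.HardDiskClusterBound
import Literature.Barriers.AtomisticToContinuum.HardDiskProfileEstimates
import HarnessLib

/-!
# Expectations of the path sums of Richthammer 2007, §6.8 (towards Lemma 13)

Companion of `HardDiskClusterBound.lean` and `HardDiskProfileEstimates.lean` (provefact
`Literature.Barriers.AtomisticToContinuum.HardDisk.Richthammer2007_hardDisk`). Lemma 13
(`μ(G_nᶜ) ≤ δ` for large `n`) rests on "the expectation of every `Σ_i` can be made arbitrarily
small when `n` is chosen big enough" [Richthammer2007, §6.8]. The three sums `Σ₁` (defined in the proof of Lemma 9, §6.4) and `Σ₂, Σ₃` (defined in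
the proof of Lemma 12, §6.7) are dominated, pathwise on hard-disc configurations, by sums over self-avoiding
bond paths `x₀, …, x_m` of the weights `(m+1)² 1{x₀ ∈ Λ_n̄} q(|x₀| - R̄)² ∏ 1_{K_ε∖K}(x_i - x_{i-1})`
(the bound on `T_n(x,x')`, the chain estimate and the path expansion of §6.1). This file proves
the part of §6.8 that does not refer to the transformation `𝔗_n`: the estimate on the
translation distances and the expectation bounds on these path sums, via Lemma 3
(`Richthammer2007_lemma3_holds`). Display numbers: the companions' (6.13)–(6.18) are this hub's
count; the arXiv PDF numbers the §6.8 displays (6.22) (bound on `T_n`), (6.23), (6.24) (`c(n)`),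
(6.25) (chain estimate) — locators below are given by section and content.

* `tDistSq`, `tDistSq_le` — the bound on `T_n` (hub (6.15'), arXiv (6.22)): `T_n(x, x') := 1{|x| ≤ |x'|} (t_n(|x| - c_K) - t_n(|x'|))²`
  satisfies `T_n(x,x') ≤ 1{x ∈ Λ_n̄} τ² (|x'| - |x| + c_K)² q(|x| - R̄)²/Q(n̄ - R̄)²`
  (`n̄ = n + c_K`, `R̄ = R + c_K`, `c_K = 1 + ε`);
* `headWeight R̄ n̄ x₀ = 1{x₀ ∈ Λ_n̄} q(|x₀| - R̄)²` and its integral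
  `∫ headWeight = ∫_{Λ_n̄} q(|x| - R̄)² dx` (`lintegral_headWeight`), bounded by `lintegral_box_qFun_sq_le` (hub (6.16), arXiv (6.23));
* `lintegral_tsum_pathFun_le` — for every measurable head weight `w`,
  `∫ μ(dX) ∑≠_{x₀,…,x_m ∈ X} w(x₀) ∏ 1_{K_ε∖K}(x_i - x_{i-1}) ≤ z^{m+1} c_ε^m ∫ w`
  (Lemma 3 and `lintegral_pathFun`), the common step of the three estimates of §6.8;
* `pathSum₁`, `lintegral_pathSum₁_le` — the majorant of `Σ₁` (and, with `m = 0`, of `Σ₂`):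
  `∫ μ(dX) ∑_m (m+1)² ∑≠ pathFun ≤ z (∫ w) ∑_m (m+1)² (z c_ε)^m`, finite when `z c_ε < 1`
  ("the sums over `m` are finite by (5.1)"); `pathSum₃`, `pathSum₁'` and their expectations for
  `Σ₃` (`lintegral_pathFun₃`: the extra point `x'` integrates to a factor `c_ε`);
* `sigma₁`, `sigma₂`, `sigma₃` — the sums `Σ₁` (§6.4), `Σ₂`, `Σ₃` (§6.7) without their constant
  prefactors `4c_f²`, `2τ²/Q(n-R)²`, `2c_f²`; `sigma₁_le_pathSum₁`, `sigma₂_le_pathSum₁`,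
  `sigma₃_le_pathSums` — their pathwise domination on hard-disc configurations
  (`ofReal_tDistSq_le_of_path`: the `T_n` bound and the chain estimate along the path; for `Σ₃` the extra point `x'`
  is either prepended to the path or is one of its `m` later points); `lintegral_sigma₁_le`,
  `lintegral_sigma₂_le`, `lintegral_sigma₃_le` — the printed expectation bounds;
* `tendsto_lintegral_sigma₁`, `tendsto_lintegral_sigma₂`, `tendsto_lintegral_sigma₃` —
  **`∫ μ(dX) Σ_i(n, X) → 0`** as `n → ∞` when `z c_ε < 1`, by `c(n) → 0` (`tendsto_cFun_zero`): the
  limit statement from which Lemma 13 (`μ(G_nᶜ) ≤ δ` for `n` large) follows by the Chebyshev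
  inequality once the good set `G_n` of (5.3) is fixed.

## References

* [Richthammer2007] T. Richthammer, *Translation-invariance of two-dimensional Gibbsian point
  processes*, Comm. Math. Phys. 274 (2007) 81–122, arXiv:0706.3637: §6.4 (proof of Lemma 9: Σ₁), §6.7 (proof of Lemma 12: Σ₂, Σ₃),
  §6.8 (pp. 17–18): the bound on `T_n(x,x')` (arXiv (6.22)), `c(n)` (arXiv (6.24)), the chain
  estimate (arXiv (6.25)), and the bounds on `∫ μ(dX) Σ_i(n, X)`.
-/

noncomputable section

open MeasureTheory Set Filter
open scoped ENNReal Topology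

namespace Literature.Barriers.AtomisticToContinuum.HardDisk

open Literature.Analysis.FunctionSpaces

/-- The plane. -/
local notation "E2" => EuclideanSpace ℝ (Fin 2)

/-! ### (6.15'): the translation distances along a cluster -/

/-- `T_n(x, x') := 1{|x| ≤ |x'|} |t_n(|x| - c_K) - t_n(|x'|)|²` (Richthammer 2007, §6.8), with
`c_K = 1 + ε` for the Euclidean unit disc. [cite: Richthammer2007, §6.8, proof of Lemma 13, definition of T_n(x,x'') (p. 17)] -/
def tDistSq (τ R : ℝ) (n : ℕ) (ε : ℝ) (x x' : E2) : ℝ :=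
  if supNorm x ≤ supNorm x' then
    (tProfile τ R n (supNorm x - (1 + ε)) - tProfile τ R n (supNorm x')) ^ 2
  else 0

/-- `T_n ≥ 0`. [folklore] -/
theorem tDistSq_nonneg (τ R : ℝ) (n : ℕ) (ε : ℝ) (x x' : E2) : 0 ≤ tDistSq τ R n ε x x' := by
  unfold tDistSq
  split_ifs
  · exact sq_nonneg _
  · exact le_rfl

/-- **The bound on `T_n`** (hub (6.15'), arXiv (6.22)): for `0 ≤ τ`, `R < n`, `ε ≥ 0`, with `n̄ = n + c_K`, `R̄ = R + c_K`, `c_K = 1 + ε`: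
`T_n(x, x') ≤ 1{x ∈ Λ_n̄} τ² (|x'| - |x| + c_K)² q(|x| - R̄)² / Q(n̄ - R̄)²` — "using the
substitution `s' := |x'|` and `s := |x| - c_K`. (If `s' ≤ R` or `s ≥ n` then `T_n(x,x') = 0`.)"
[cite: Richthammer2007, §6.8, the bound on T_n(x,x') (arXiv display (6.22)) (p. 17)] -/
theorem tDistSq_le {τ R ε : ℝ} {n : ℕ} (hτ : 0 ≤ τ) (hRn : R < n) (hε : 0 ≤ ε) (x x' : E2) :
    tDistSq τ R n ε x x' ≤ (box ((n : ℝ) + (1 + ε))).indicator (fun _ => (1 : ℝ)) x *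
      (τ ^ 2 * (supNorm x' - supNorm x + (1 + ε)) ^ 2 * qFun (supNorm x - (R + (1 + ε))) ^ 2 /
        QFun ((n : ℝ) - R) ^ 2) := by
  have hrhs0 : 0 ≤ (box ((n : ℝ) + (1 + ε))).indicator (fun _ => (1 : ℝ)) x *
      (τ ^ 2 * (supNorm x' - supNorm x + (1 + ε)) ^ 2 * qFun (supNorm x - (R + (1 + ε))) ^ 2 /
        QFun ((n : ℝ) - R) ^ 2) :=
    mul_nonneg (Set.indicator_nonneg (fun _ _ => zero_le_one) _) (by positivity)
  unfold tDistSq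
  split_ifs with hxx'
  · set s : ℝ := supNorm x - (1 + ε) with hs
    set s' : ℝ := supNorm x' with hs'
    have hss' : s ≤ s' := by rw [hs, hs']; linarith
    rcases le_or_gt s' R with h1 | h1
    · -- both translation distances equal `τ`
      rw [tProfile_eq_of_le (hss'.trans h1) hRn, tProfile_eq_of_le h1 hRn, sub_self]
      simpa using hrhs0
    rcases le_or_gt (n : ℝ) s with h2 | h2
    · -- both vanish
      rw [tProfile_eq_zero_of_le h2, tProfile_eq_zero_of_le (h2.trans hss'), sub_self]
      simpa using hrhs0
    -- the main case: the Lipschitz estimate on `r`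
    have hb := tProfile_sub_bounds (τ := τ) hτ hRn hss' h2.le
    have hxbox : x ∈ box ((n : ℝ) + (1 + ε)) := mem_box_of_supNorm_lt (by rw [hs] at h2; linarith)
    rw [Set.indicator_of_mem hxbox, one_mul]
    have hQ : 0 < QFun ((n : ℝ) - R) := QFun_pos (sub_pos.2 hRn)
    have e1 : s' - s = supNorm x' - supNorm x + (1 + ε) := by rw [hs, hs']; ring
    have e2 : s - R = supNorm x - (R + (1 + ε)) := by rw [hs]; ring
    rw [e1, e2] at hb
    have hd0 := hb.1
    have hd1 := hb.2
    calc (tProfile τ R n s - tProfile τ R n s') ^ 2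
        ≤ (τ * ((supNorm x' - supNorm x + (1 + ε)) * qFun (supNorm x - (R + (1 + ε))) /
            QFun ((n : ℝ) - R))) ^ 2 := pow_le_pow_left₀ hd0 hd1 2
      _ = τ ^ 2 * (supNorm x' - supNorm x + (1 + ε)) ^ 2 * qFun (supNorm x - (R + (1 + ε))) ^ 2 /
            QFun ((n : ℝ) - R) ^ 2 := by
          field_simp
  · exact hrhs0

/-! ### The head weight and its integral -/

/-- The head weight `w(x₀) = 1{x₀ ∈ Λ_n̄} q(|x₀| - R̄)²` of the path expansions of §6.8.
[cite: Richthammer2007, §6.8 (p. 18)] -/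
def headWeight (Rb nb : ℝ) (x : E2) : ℝ≥0∞ :=
  (box nb).indicator 1 x * ENNReal.ofReal (qFun (supNorm x - Rb) ^ 2)

/-- The head weight is measurable. [folklore] -/
theorem measurable_headWeight (Rb nb : ℝ) : Measurable (headWeight Rb nb) := by
  unfold headWeight
  refine (measurable_one.indicator (measurableSet_box _)).mul (ENNReal.measurable_ofReal.comp ?_)
  exact (continuous_qFun.measurable.comp (measurable_supNorm.sub measurable_const)).pow_const 2

/-- The head weight is at most `1`. [folklore] -/
theorem headWeight_le_one (Rb nb : ℝ) (x : E2) : headWeight Rb nb x ≤ 1 := by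
  unfold headWeight
  refine mul_le_one' (Set.indicator_le_self' (fun _ _ => zero_le) x |>.trans (le_of_eq rfl)) ?_
  rw [← ENNReal.ofReal_one]
  refine ENNReal.ofReal_le_ofReal ?_
  have h1 := qFun_le_one (supNorm x - Rb)
  have h0 := (qFun_pos (supNorm x - Rb)).le
  nlinarith

/-- `∫ w = ∫_{Λ_n̄} q(|x| - R̄)² dx`. [cite: Richthammer2007, §6.8, definition of c(n) (arXiv display (6.24)) (p. 17)] -/
theorem lintegral_headWeight (Rb nb : ℝ) :
    ∫⁻ x, headWeight Rb nb x ∂volume = ∫⁻ x in box nb, ENNReal.ofReal (qFun (supNorm x - Rb) ^ 2) ∂volume := by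
  unfold headWeight
  rw [← lintegral_indicator (measurableSet_box _)]
  refine lintegral_congr fun x => ?_
  by_cases hx : x ∈ box nb
  · rw [Set.indicator_of_mem hx, Set.indicator_of_mem hx, Pi.one_apply, one_mul]
  · rw [Set.indicator_of_notMem hx, Set.indicator_of_notMem hx, zero_mul]

/-! ### Expectations of path sums -/

/-- **The common step of §6.8**: for a measurable head weight `w`, by Lemma 3 and translation
invariance, `∫ μ(dX) ∑≠_{x₀,…,x_m ∈ X} w(x₀) ∏ 1_{K_ε∖K}(x_i - x_{i-1}) ≤ z^{m+1} (∫ w) c_ε^m`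
("Using Lemma 3 we can thus proceed as in the proof of Lemma 7", §6.8). [cite: Richthammer2007, §6.8 (p. 18)] -/
theorem lintegral_tsum_pathFun_le {z : ℝ} (hz : 0 < z) {μ : Measure (PointConfig E2)}
    (hμ : IsGibbs z μ) {w : E2 → ℝ≥0∞} (hw : Measurable w) (ε : ℝ) (m : ℕ) :
    ∫⁻ X, (∑' x : {x : Fin (m + 1) → E2 // Function.Injective x ∧ ∀ i, x i ∈ X}, pathFun w ε m x.1) ∂μ ≤
      ENNReal.ofReal z ^ (m + 1) * ((∫⁻ b, w b ∂volume) * volume (annulus ε) ^ m) := by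
  rw [← lintegral_pathFun hw ε m]
  exact Richthammer2007_lemma3_holds z hz μ hμ (m + 1) _ (measurable_pathFun hw ε m)

/-- **The path sum majorising `Σ₁`** (and `Σ₃`'s second part, and `Σ₂` through its `m = 0` term):
`∑_m (m+1)² ∑≠_{x₀,…,x_m ∈ X} w(x₀) ∏ 1_{K_ε∖K}(x_i - x_{i-1})`. [cite: Richthammer2007, §6.8 (p. 18)] -/
def pathSum₁ (w : E2 → ℝ≥0∞) (ε : ℝ) (X : PointConfig E2) : ℝ≥0∞ :=
  ∑' m : ℕ, ((m : ℝ≥0∞) + 1) ^ 2 *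
    ∑' x : {x : Fin (m + 1) → E2 // Function.Injective x ∧ ∀ i, x i ∈ X}, pathFun w ε m x.1

/-- The path sum is measurable. [folklore] -/
theorem measurable_pathSum₁ {w : E2 → ℝ≥0∞} (hw : Measurable w) (ε : ℝ) : Measurable (pathSum₁ w ε) := by
  unfold pathSum₁
  exact Measurable.tsum fun m => (measurable_tsum_injective (measurable_pathFun hw ε m)).const_mul _

/-- **Expectation of the path sum**: `∫ μ(dX) pathSum₁ ≤ z (∫ w) ∑_m (m+1)² (z c_ε)^m`
("`∫ μ(dX) Σ₁(n,X) ≤ zξc ∑_{m ≥ 0} (m+1)² (c_ε z ξ)^m c(n)`", §6.8). [cite: Richthammer2007, §6.8 (p. 18)] -/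
theorem lintegral_pathSum₁_le {z : ℝ} (hz : 0 < z) {μ : Measure (PointConfig E2)} (hμ : IsGibbs z μ)
    {w : E2 → ℝ≥0∞} (hw : Measurable w) (ε : ℝ) :
    ∫⁻ X, pathSum₁ w ε X ∂μ ≤ ENNReal.ofReal z * (∫⁻ b, w b ∂volume) *
      ∑' m : ℕ, ((m : ℝ≥0∞) + 1) ^ 2 * (ENNReal.ofReal z * volume (annulus ε)) ^ m := by
  unfold pathSum₁
  rw [lintegral_tsum fun m =>
    ((measurable_tsum_injective (measurable_pathFun hw ε m)).const_mul _).aemeasurable]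
  rw [← ENNReal.tsum_mul_left]
  refine ENNReal.tsum_le_tsum fun m => ?_
  rw [lintegral_const_mul _ (measurable_tsum_injective (measurable_pathFun hw ε m))]
  calc ((m : ℝ≥0∞) + 1) ^ 2 * ∫⁻ X, (∑' x : {x : Fin (m + 1) → E2 // Function.Injective x ∧ ∀ i, x i ∈ X},
        pathFun w ε m x.1) ∂μ
      ≤ ((m : ℝ≥0∞) + 1) ^ 2 * (ENNReal.ofReal z ^ (m + 1) * ((∫⁻ b, w b ∂volume) * volume (annulus ε) ^ m)) :=
        mul_le_mul' le_rfl (lintegral_tsum_pathFun_le hz hμ hw ε m)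
    _ = ENNReal.ofReal z * (∫⁻ b, w b ∂volume) * (((m : ℝ≥0∞) + 1) ^ 2 * (ENNReal.ofReal z * volume (annulus ε)) ^ m) := by
        ring

/-- The series `∑_m (m+1)² r^m` is finite for `r < 1` ("the sums over `m` are finite by (5.1)").
[cite: Richthammer2007, §6.8 (p. 18)] -/
theorem tsum_sq_mul_pow_lt_top {r : ℝ≥0∞} (hr : r < 1) :
    ∑' m : ℕ, ((m : ℝ≥0∞) + 1) ^ 2 * r ^ m < ⊤ := by
  have hrtop : r ≠ ⊤ := ne_top_of_lt hr
  set q : ℝ := r.toReal with hq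
  have hq0 : 0 ≤ q := ENNReal.toReal_nonneg
  have hq1 : q < 1 := by
    rw [hq, ← ENNReal.toReal_one]
    exact (ENNReal.toReal_lt_toReal hrtop ENNReal.one_ne_top).2 hr
  have hrq : r = ENNReal.ofReal q := by rw [hq, ENNReal.ofReal_toReal hrtop]
  have hnorm : ‖q‖ < 1 := by rw [Real.norm_eq_abs, abs_of_nonneg hq0]; exact hq1
  -- `(m+1)² = m² + 2m + 1`
  have hs2 : Summable fun m : ℕ => (m : ℝ) ^ 2 * q ^ m := summable_pow_mul_geometric_of_norm_lt_one 2 hnorm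
  have hs1 : Summable fun m : ℕ => (m : ℝ) ^ 1 * q ^ m := summable_pow_mul_geometric_of_norm_lt_one 1 hnorm
  have hs0 : Summable fun m : ℕ => q ^ m := summable_geometric_of_lt_one hq0 hq1
  have hsum : Summable fun m : ℕ => ((m : ℝ) + 1) ^ 2 * q ^ m := by
    have := (hs2.add (hs1.mul_left 2)).add hs0
    refine this.congr fun m => ?_
    ring
  have heq : (fun m : ℕ => ((m : ℝ≥0∞) + 1) ^ 2 * r ^ m) = fun m : ℕ => ENNReal.ofReal (((m : ℝ) + 1) ^ 2 * q ^ m) := by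
    funext m
    rw [ENNReal.ofReal_mul (by positivity), ENNReal.ofReal_pow hq0, ENNReal.ofReal_pow (by positivity),
      ENNReal.ofReal_add (Nat.cast_nonneg m) zero_le_one, ENNReal.ofReal_natCast, ENNReal.ofReal_one, hrq]
  rw [heq, ← ENNReal.ofReal_tsum_of_nonneg (fun m => by positivity) hsum]
  exact ENNReal.ofReal_lt_top

/-! ### The sums `Σ₁` (§6.4), `Σ₂` (§6.7) and their domination by path sums -/

/-- **`Σ₁` (proof of Lemma 9, §6.4), without the constant `4 c_f²`**: the sum over all pairs `x, x' ∈ X`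
connected in `(X, K_n^{X,ε})` of `T_n(x, x') = 1{|x| ≤ |x'|}(t_n(|x| - c_K) - t_n(|x'|))²`.
[cite: Richthammer2007, §6.4, proof of Lemma 9, display defining Σ₁ (p. 15)] -/
def sigma₁ (τ R : ℝ) (n : ℕ) (ε : ℝ) (X : PointConfig E2) : ℝ≥0∞ :=
  ∑' p : {p : E2 × E2 // p.1 ∈ X ∧ p.2 ∈ X ∧ epsConnected ε n X p.1 p.2},
    ENNReal.ofReal (tDistSq τ R n ε p.1.1 p.1.2)

/-- **`Σ₂` (proof of Lemma 12, §6.7), without the constant `2τ²/Q(n-R)²`**: `∑_{x ∈ X ∩ Λ_n} q(|x| - R)²`.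
[cite: Richthammer2007, §6.7, proof of Lemma 12, display defining Σ₂ and Σ₃ (p. 17)] -/
def sigma₂ (R : ℝ) (n : ℕ) (X : PointConfig E2) : ℝ≥0∞ :=
  ∑' x : ((X : PointConfig E2) : Set E2), (box (n : ℝ)).indicator 1 (x : E2) *
    ENNReal.ofReal (qFun (supNorm (x : E2) - R) ^ 2)

/-- Sums over a sigma type of paths are the iterated sums of `pathSum₁`. [folklore] -/
theorem tsum_sigma_pathFun (w : E2 → ℝ≥0∞) (ε : ℝ) (C : ℝ≥0∞) (X : PointConfig E2) :
    ∑' σ : (Σ m : ℕ, {x : Fin (m + 1) → E2 // Function.Injective x ∧ ∀ i, x i ∈ X}),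
        C * (((σ.1 : ℝ≥0∞) + 1) ^ 2 * pathFun w ε σ.1 σ.2.1) = C * pathSum₁ w ε X := by
  rw [ENNReal.tsum_sigma']
  dsimp only
  simp_rw [ENNReal.tsum_mul_left]
  rfl

/-- **The termwise bound behind the three estimates of §6.8**: on a hard-disc configuration, for a
self-avoiding bond path `p : x = x₀, …, x_m = x''`, by the `T_n` bound and the chain estimate,
`T_n(x, x'') ≤ (τ² c_K²/Q(n-R)²) (m+1)² · w(x₀) ∏ 1_{K_ε∖K}(x_i - x_{i-1})` with the head weight
`w = 1_{Λ_n̄} q(|·| - R̄)²` (the product being `1` on the path). [cite: Richthammer2007, §6.8 (p. 18)] -/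
theorem ofReal_tDistSq_le_of_path {τ R ε : ℝ} {n : ℕ} (hτ : 0 ≤ τ) (hRn : R < n) (hε : 0 < ε)
    {X : PointConfig E2} (hX : IsHardCore X) {m : ℕ} {p : Fin (m + 1) → E2}
    (hinj : Function.Injective p) (hmem : ∀ i, p i ∈ X)
    (hb : ∀ i : Fin m, epsBond ε n (p i.castSucc) (p i.succ)) :
    ENNReal.ofReal (tDistSq τ R n ε (p 0) (p (Fin.last m))) ≤
      ENNReal.ofReal (τ ^ 2 * (1 + ε) ^ 2 / QFun ((n : ℝ) - R) ^ 2) *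
        ((((m : ℝ≥0∞)) + 1) ^ 2 * pathFun (headWeight (R + (1 + ε)) ((n : ℝ) + (1 + ε))) ε m p) := by
  rw [pathFun_eq_of_path hX _ hinj hmem hb, headWeight]
  have h1 := tDistSq_le hτ hRn hε.le (p 0) (p (Fin.last m))
  have hdiff : |supNorm (p (Fin.last m)) - supNorm (p 0)| ≤ m * (1 + ε) := by
    have h := abs_supNorm_sub_le_of_path hb m le_rfl
    rwa [show (⟨m, Nat.lt_succ_of_le le_rfl⟩ : Fin (m + 1)) = Fin.last m from rfl] at h
  have h2 := sq_sub_add_le (by linarith : (0 : ℝ) ≤ 1 + ε) hdiff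
  by_cases hbox : p 0 ∈ box ((n : ℝ) + (1 + ε))
  · rw [Set.indicator_of_mem hbox, one_mul] at h1
    rw [Set.indicator_of_mem hbox, Pi.one_apply, one_mul]
    have hq0 : 0 ≤ qFun (supNorm (p 0) - (R + (1 + ε))) ^ 2 := sq_nonneg _
    have hQ0 : 0 ≤ QFun ((n : ℝ) - R) ^ 2 := sq_nonneg _
    calc ENNReal.ofReal (tDistSq τ R n ε (p 0) (p (Fin.last m)))
        ≤ ENNReal.ofReal (τ ^ 2 * (supNorm (p (Fin.last m)) - supNorm (p 0) + (1 + ε)) ^ 2 *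
            qFun (supNorm (p 0) - (R + (1 + ε))) ^ 2 / QFun ((n : ℝ) - R) ^ 2) := ENNReal.ofReal_le_ofReal h1
      _ ≤ ENNReal.ofReal ((τ ^ 2 * (1 + ε) ^ 2 / QFun ((n : ℝ) - R) ^ 2) *
            ((((m : ℝ)) + 1) ^ 2 * qFun (supNorm (p 0) - (R + (1 + ε))) ^ 2)) := by
          refine ENNReal.ofReal_le_ofReal ?_
          rw [div_mul_eq_mul_div]
          refine div_le_div_of_nonneg_right ?_ hQ0
          have hτ2 : 0 ≤ τ ^ 2 := sq_nonneg _
          nlinarith [mul_le_mul_of_nonneg_left h2 (mul_nonneg hτ2 hq0)]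
      _ = ENNReal.ofReal (τ ^ 2 * (1 + ε) ^ 2 / QFun ((n : ℝ) - R) ^ 2) *
            (((m : ℝ≥0∞) + 1) ^ 2 * ENNReal.ofReal (qFun (supNorm (p 0) - (R + (1 + ε))) ^ 2)) := by
          rw [ENNReal.ofReal_mul (by positivity), ENNReal.ofReal_mul (by positivity),
            ENNReal.ofReal_pow (by positivity), ENNReal.ofReal_add (Nat.cast_nonneg _) zero_le_one,
            ENNReal.ofReal_natCast, ENNReal.ofReal_one]
  · rw [Set.indicator_of_notMem hbox, zero_mul] at h1
    rw [ENNReal.ofReal_of_nonpos h1]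
    exact zero_le

/-- **`Σ₁` is dominated by the path sum** on hard-disc configurations:
`Σ₁ ≤ (τ² c_K² / Q(n-R)²) · ∑_m (m+1)² ∑≠ 1{x₀ ∈ Λ_n̄} q(|x₀|-R̄)² ∏ 1_{K_ε∖K}(x_i - x_{i-1})`
("we can estimate the summands of `Σ₁(n,X)` by considering all paths `x₀,…,x_m` in the graph
`(X, K_n^{X,ε})` connecting `x = x₀` and `x'' = x_m`. By [the `T_n` bound] and [the chain
estimate] …", §6.8).
[cite: Richthammer2007, §6.8 (p. 18)] -/
theorem sigma₁_le_pathSum₁ {τ R ε : ℝ} {n : ℕ} (hτ : 0 ≤ τ) (hRn : R < n) (hε : 0 < ε)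
    {X : PointConfig E2} (hX : IsHardCore X) :
    sigma₁ τ R n ε X ≤ ENNReal.ofReal (τ ^ 2 * (1 + ε) ^ 2 / QFun ((n : ℝ) - R) ^ 2) *
      pathSum₁ (headWeight (R + (1 + ε)) ((n : ℝ) + (1 + ε))) ε X := by
  classical
  set C : ℝ≥0∞ := ENNReal.ofReal (τ ^ 2 * (1 + ε) ^ 2 / QFun ((n : ℝ) - R) ^ 2) with hC
  set w : E2 → ℝ≥0∞ := headWeight (R + (1 + ε)) ((n : ℝ) + (1 + ε)) with hw
  set I := {p : E2 × E2 // p.1 ∈ X ∧ p.2 ∈ X ∧ epsConnected ε n X p.1 p.2} with hI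
  set S := (Σ m : ℕ, {x : Fin (m + 1) → E2 // Function.Injective x ∧ ∀ i, x i ∈ X}) with hS
  -- choose a self-avoiding path for every connected pair
  have hpath : ∀ p : I, ∃ σ : S, σ.2.1 0 = p.1.1 ∧ σ.2.1 (Fin.last σ.1) = p.1.2 ∧
      ∀ i : Fin σ.1, epsBond ε n (σ.2.1 i.castSucc) (σ.2.1 i.succ) := by
    intro p
    obtain ⟨m, y, hinj, hmem, hy0, hym, hb⟩ := exists_path_of_epsConnected p.2.1 p.2.2.2
    exact ⟨⟨m, y, hinj, hmem⟩, hy0, hym, hb⟩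
  choose Θ hΘ0 hΘm hΘb using hpath
  have hΘinj : Function.Injective Θ := by
    intro p p' h
    apply Subtype.ext
    apply Prod.ext
    · rw [← hΘ0 p, ← hΘ0 p', h]
    · rw [← hΘm p, ← hΘm p', h]
  -- termwise bound
  set g : S → ℝ≥0∞ := fun σ => C * (((σ.1 : ℝ≥0∞) + 1) ^ 2 * pathFun w ε σ.1 σ.2.1) with hg
  have hterm : ∀ p : I, ENNReal.ofReal (tDistSq τ R n ε p.1.1 p.1.2) ≤ g (Θ p) := by
    intro p
    have h := ofReal_tDistSq_le_of_path hτ hRn hε hX (Θ p).2.2.1 (Θ p).2.2.2 (hΘb p)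
    rw [hΘ0 p, hΘm p] at h
    simpa only [hg, hC, hw] using h
  -- sum
  calc sigma₁ τ R n ε X = ∑' p : I, ENNReal.ofReal (tDistSq τ R n ε p.1.1 p.1.2) := rfl
    _ ≤ ∑' p : I, g (Θ p) := ENNReal.tsum_le_tsum hterm
    _ ≤ ∑' σ : S, g σ := ENNReal.tsum_comp_le_tsum_of_injective hΘinj g
    _ = C * pathSum₁ w ε X := tsum_sigma_pathFun w ε C X

/-- **`Σ₂` is dominated by the `m = 0` term of the path sum** (pointwise):
`∑_{x ∈ X ∩ Λ_n} q(|x| - R)² ≤ ∑_{x ∈ X} 1{x ∈ Λ_n̄} q(|x| - R̄)² ≤ pathSum₁` (`q` decreasing,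
`Λ_n ⊆ Λ_n̄`). [cite: Richthammer2007, §6.8 (p. 18)] -/
theorem sigma₂_le_pathSum₁ {R ε : ℝ} (hε : 0 ≤ ε) (n : ℕ) (X : PointConfig E2) :
    sigma₂ R n X ≤ pathSum₁ (headWeight (R + (1 + ε)) ((n : ℝ) + (1 + ε))) ε X := by
  classical
  set w : E2 → ℝ≥0∞ := headWeight (R + (1 + ε)) ((n : ℝ) + (1 + ε)) with hw
  set S := (Σ m : ℕ, {x : Fin (m + 1) → E2 // Function.Injective x ∧ ∀ i, x i ∈ X}) with hS
  -- points as paths of length `0`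
  set Θ : ((X : PointConfig E2) : Set E2) → S := fun x =>
    ⟨0, fun _ => (x : E2), fun a b _ => Fin.ext (by have ha := a.2; have hb := b.2; omega),
      fun _ => x.2⟩ with hΘ
  have hΘinj : Function.Injective Θ := by
    intro x x' h
    have := congrArg (fun σ : S => σ.2.1 0) h
    exact Subtype.ext this
  set g : S → ℝ≥0∞ := fun σ => 1 * (((σ.1 : ℝ≥0∞) + 1) ^ 2 * pathFun w ε σ.1 σ.2.1) with hg
  have hterm : ∀ x : ((X : PointConfig E2) : Set E2),
      (box (n : ℝ)).indicator 1 (x : E2) * ENNReal.ofReal (qFun (supNorm (x : E2) - R) ^ 2) ≤ g (Θ x) := by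
    intro x
    rw [hg, hΘ]
    dsimp only
    rw [Nat.cast_zero, zero_add, one_pow, one_mul, one_mul]
    unfold pathFun
    simp only [Finset.univ_eq_empty, Finset.prod_empty, mul_one]
    rw [hw, headWeight]
    by_cases hx : (x : E2) ∈ box (n : ℝ)
    · have hx' : (x : E2) ∈ box ((n : ℝ) + (1 + ε)) := box_mono (by linarith) hx
      rw [Set.indicator_of_mem hx, Set.indicator_of_mem hx', Pi.one_apply, one_mul, one_mul]
      refine ENNReal.ofReal_le_ofReal ?_
      have h1 : qFun (supNorm (x : E2) - R) ≤ qFun (supNorm (x : E2) - (R + (1 + ε))) :=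
        qFun_antitone (by linarith)
      have h0 := (qFun_pos (supNorm (x : E2) - R)).le
      nlinarith
    · rw [Set.indicator_of_notMem hx, zero_mul]
      exact zero_le
  calc sigma₂ R n X ≤ ∑' x : ((X : PointConfig E2) : Set E2), g (Θ x) := ENNReal.tsum_le_tsum hterm
    _ ≤ ∑' σ : S, g σ := ENNReal.tsum_comp_le_tsum_of_injective hΘinj g
    _ = 1 * pathSum₁ w ε X := tsum_sigma_pathFun w ε 1 X
    _ = pathSum₁ w ε X := one_mul _

/-- **Expectation of `Σ₁`** (Richthammer 2007, §6.8): for a Gibbs measure `μ`,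
`∫ μ(dX) Σ₁ ≤ (τ² c_K²/Q(n-R)²) · z · ∫_{Λ_n̄} q(|x|-R̄)² dx · ∑_m (m+1)² (z c_ε)^m`.
[cite: Richthammer2007, §6.8 (p. 18)] -/
theorem lintegral_sigma₁_le {z : ℝ} (hz : 0 < z) {μ : Measure (PointConfig E2)} (hμ : IsGibbs z μ)
    {τ R ε : ℝ} {n : ℕ} (hτ : 0 ≤ τ) (hRn : R < n) (hε : 0 < ε) :
    ∫⁻ X, sigma₁ τ R n ε X ∂μ ≤ ENNReal.ofReal (τ ^ 2 * (1 + ε) ^ 2 / QFun ((n : ℝ) - R) ^ 2) *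
      (ENNReal.ofReal z * (∫⁻ x in box ((n : ℝ) + (1 + ε)), ENNReal.ofReal (qFun (supNorm x - (R + (1 + ε))) ^ 2) ∂volume) *
        ∑' m : ℕ, ((m : ℝ≥0∞) + 1) ^ 2 * (ENNReal.ofReal z * volume (annulus ε)) ^ m) := by
  have hw := measurable_headWeight (R + (1 + ε)) ((n : ℝ) + (1 + ε))
  calc ∫⁻ X, sigma₁ τ R n ε X ∂μ
      ≤ ∫⁻ X, ENNReal.ofReal (τ ^ 2 * (1 + ε) ^ 2 / QFun ((n : ℝ) - R) ^ 2) *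
          pathSum₁ (headWeight (R + (1 + ε)) ((n : ℝ) + (1 + ε))) ε X ∂μ := by
        refine lintegral_mono_ae ?_
        filter_upwards [hμ.ae_isHardCore] with X hX
        exact sigma₁_le_pathSum₁ hτ hRn hε hX
    _ = ENNReal.ofReal (τ ^ 2 * (1 + ε) ^ 2 / QFun ((n : ℝ) - R) ^ 2) *
          ∫⁻ X, pathSum₁ (headWeight (R + (1 + ε)) ((n : ℝ) + (1 + ε))) ε X ∂μ :=
        lintegral_const_mul _ (measurable_pathSum₁ hw ε)
    _ ≤ _ := by
        refine mul_le_mul' le_rfl ?_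
        rw [← lintegral_headWeight]
        exact lintegral_pathSum₁_le hz hμ hw ε

/-- **Expectation of `Σ₂`** (Richthammer 2007, §6.8; printed sharper as `2zξτ² c(n)`):
`∫ μ(dX) Σ₂ ≤ z · ∫_{Λ_n̄} q(|x|-R̄)² dx · ∑_m (m+1)² (z c_ε)^m`. [cite: Richthammer2007, §6.8 (p. 18)] -/
theorem lintegral_sigma₂_le {z : ℝ} (hz : 0 < z) {μ : Measure (PointConfig E2)} (hμ : IsGibbs z μ)
    (R : ℝ) {ε : ℝ} (hε : 0 ≤ ε) (n : ℕ) :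
    ∫⁻ X, sigma₂ R n X ∂μ ≤
      ENNReal.ofReal z * (∫⁻ x in box ((n : ℝ) + (1 + ε)), ENNReal.ofReal (qFun (supNorm x - (R + (1 + ε))) ^ 2) ∂volume) *
        ∑' m : ℕ, ((m : ℝ≥0∞) + 1) ^ 2 * (ENNReal.ofReal z * volume (annulus ε)) ^ m := by
  have hw := measurable_headWeight (R + (1 + ε)) ((n : ℝ) + (1 + ε))
  calc ∫⁻ X, sigma₂ R n X ∂μ ≤ ∫⁻ X, pathSum₁ (headWeight (R + (1 + ε)) ((n : ℝ) + (1 + ε))) ε X ∂μ :=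
        lintegral_mono fun X => sigma₂_le_pathSum₁ hε n X
    _ ≤ _ := by
        rw [← lintegral_headWeight]
        exact lintegral_pathSum₁_le hz hμ hw ε

/-! ### The sum `Σ₃` (§6.7) -/

/-- **`Σ₃` (proof of Lemma 12, §6.7), without the constant `2 c_f²`**: the sum over `x ≠ x' ∈ X` with
`x' - x ∈ K_ε` and `x'' ∈ X` connected to `x` of `T_n(x, x'')`. [cite: Richthammer2007, §6.7, proof of Lemma 12, display defining Σ₂ and Σ₃ (p. 17)] -/
def sigma₃ (τ R : ℝ) (n : ℕ) (ε : ℝ) (X : PointConfig E2) : ℝ≥0∞ :=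
  ∑' t : {t : E2 × E2 × E2 // t.1 ∈ X ∧ t.2.1 ∈ X ∧ t.2.2 ∈ X ∧ t.1 ≠ t.2.1 ∧
      dist t.2.1 t.1 < 1 + ε ∧ epsConnected ε n X t.1 t.2.2},
    ENNReal.ofReal (tDistSq τ R n ε t.1.1 t.1.2.2)

/-- The path sum majorising the part of `Σ₃` where `x'` is not on the path from `x` to `x''`:
`∑_m (m+1)² ∑≠_{x', x₀, …, x_m} 1_{K_ε∖K}(x' - x₀) w(x₀) ∏ 1_{K_ε∖K}(x_i - x_{i-1})`.
[cite: Richthammer2007, §6.8 (p. 18)] -/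
def pathSum₃ (w : E2 → ℝ≥0∞) (ε : ℝ) (X : PointConfig E2) : ℝ≥0∞ :=
  ∑' m : ℕ, ((m : ℝ≥0∞) + 1) ^ 2 *
    ∑' y : {y : Fin (m + 2) → E2 // Function.Injective y ∧ ∀ i, y i ∈ X},
      (annulus ε).indicator 1 (y.1 0 - y.1 1) * pathFun w ε m (Fin.tail y.1)

/-- The path sum majorising the part of `Σ₃` where `x'` lies on the path ("the second sum in the
brackets can be estimated by `m`"): `∑_m (m+1)² m ∑≠ w(x₀) ∏ 1_{K_ε∖K}(x_i - x_{i-1})`.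
[cite: Richthammer2007, §6.8 (p. 18)] -/
def pathSum₁' (w : E2 → ℝ≥0∞) (ε : ℝ) (X : PointConfig E2) : ℝ≥0∞ :=
  ∑' m : ℕ, ((m : ℝ≥0∞) + 1) ^ 2 * (m : ℝ≥0∞) *
    ∑' x : {x : Fin (m + 1) → E2 // Function.Injective x ∧ ∀ i, x i ∈ X}, pathFun w ε m x.1

/-- The summand of `pathSum₃` is measurable. [folklore] -/
theorem measurable_pathFun₃ {w : E2 → ℝ≥0∞} (hw : Measurable w) (ε : ℝ) (m : ℕ) :
    Measurable fun y : Fin (m + 2) → E2 => (annulus ε).indicator 1 (y 0 - y 1) * pathFun w ε m (Fin.tail y) := by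
  refine Measurable.mul ?_ ((measurable_pathFun hw ε m).comp (measurable_pi_lambda _ fun i => measurable_pi_apply _))
  exact (measurable_one.indicator (measurableSet_annulus ε)).comp ((measurable_pi_apply 0).sub (measurable_pi_apply 1))

/-- `pathSum₃` is measurable. [folklore] -/
theorem measurable_pathSum₃ {w : E2 → ℝ≥0∞} (hw : Measurable w) (ε : ℝ) : Measurable (pathSum₃ w ε) := by
  unfold pathSum₃
  exact Measurable.tsum fun m => (measurable_tsum_injective (measurable_pathFun₃ hw ε m)).const_mul _

/-- `pathSum₁'` is measurable. [folklore] -/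
theorem measurable_pathSum₁' {w : E2 → ℝ≥0∞} (hw : Measurable w) (ε : ℝ) : Measurable (pathSum₁' w ε) := by
  unfold pathSum₁'
  exact Measurable.tsum fun m => (measurable_tsum_injective (measurable_pathFun hw ε m)).const_mul _

/-- **Integrating out the extra point `x'`**: `∫ 1_{K_ε∖K}(x' - x₀) pathFun(x) dx' dx = c_ε ∫ pathFun`
("the first sum … gives an additional factor `z ξ c_ε`", §6.8). [cite: Richthammer2007, §6.8 (p. 18)] -/
theorem lintegral_pathFun₃ {w : E2 → ℝ≥0∞} (hw : Measurable w) (ε : ℝ) (m : ℕ) :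
    ∫⁻ y, (annulus ε).indicator 1 (y 0 - y 1) * pathFun w ε m (Fin.tail y)
        ∂(Measure.pi fun _ : Fin (m + 2) => (volume : Measure E2)) =
      volume (annulus ε) * ((∫⁻ b, w b ∂volume) * volume (annulus ε) ^ m) := by
  rw [IsPoissonPointProcess.lintegral_pi_succ_eq_lintegral_lintegral_cons volume (m + 1) (measurable_pathFun₃ hw ε m)]
  have hcons : ∀ (b : E2) (x : Fin (m + 1) → E2),
      (annulus ε).indicator (1 : E2 → ℝ≥0∞) ((Fin.cons b x : Fin (m + 2) → E2) 0 - (Fin.cons b x : Fin (m + 2) → E2) 1) *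
        pathFun w ε m (Fin.tail (Fin.cons b x : Fin (m + 2) → E2)) = (annulus ε).indicator 1 (b - x 0) * pathFun w ε m x := by
    intro b x
    rw [Fin.tail_cons, Fin.cons_zero]
    rfl
  simp_rw [hcons]
  -- swap the order of integration
  rw [lintegral_lintegral_swap]
  · have hinner : ∀ x : Fin (m + 1) → E2, ∫⁻ b, (annulus ε).indicator (1 : E2 → ℝ≥0∞) (b - x 0) * pathFun w ε m x ∂volume =
        volume (annulus ε) * pathFun w ε m x := by
      intro x
      have hmi : Measurable (fun b : E2 => (annulus ε).indicator (1 : E2 → ℝ≥0∞) (b - x 0)) :=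
        (measurable_one.indicator (measurableSet_annulus ε)).comp (measurable_id.sub_const _)
      rw [lintegral_mul_const _ hmi, lintegral_indicator_sub_const (measurableSet_annulus ε)]
    simp_rw [hinner]
    rw [lintegral_const_mul _ (measurable_pathFun hw ε m), lintegral_pathFun hw ε m]
  · refine Measurable.aemeasurable ?_
    refine Measurable.mul ?_ ((measurable_pathFun hw ε m).comp measurable_snd)
    exact (measurable_one.indicator (measurableSet_annulus ε)).comp
      (measurable_fst.sub ((measurable_pi_apply 0).comp measurable_snd))

/-- **Expectation of `pathSum₃`**: `≤ z (∫ w) (z c_ε) ∑_m (m+1)² (z c_ε)^m`. [cite: Richthammer2007, §6.8 (p. 18)] -/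
theorem lintegral_pathSum₃_le {z : ℝ} (hz : 0 < z) {μ : Measure (PointConfig E2)} (hμ : IsGibbs z μ)
    {w : E2 → ℝ≥0∞} (hw : Measurable w) (ε : ℝ) :
    ∫⁻ X, pathSum₃ w ε X ∂μ ≤ ENNReal.ofReal z * (∫⁻ b, w b ∂volume) * (ENNReal.ofReal z * volume (annulus ε)) *
      ∑' m : ℕ, ((m : ℝ≥0∞) + 1) ^ 2 * (ENNReal.ofReal z * volume (annulus ε)) ^ m := by
  unfold pathSum₃
  rw [lintegral_tsum fun m =>
    ((measurable_tsum_injective (measurable_pathFun₃ hw ε m)).const_mul _).aemeasurable]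
  rw [← ENNReal.tsum_mul_left]
  refine ENNReal.tsum_le_tsum fun m => ?_
  rw [lintegral_const_mul _ (measurable_tsum_injective (measurable_pathFun₃ hw ε m))]
  have hL3 := Richthammer2007_lemma3_holds z hz μ hμ (m + 2) _ (measurable_pathFun₃ hw ε m)
  rw [lintegral_pathFun₃ hw ε m] at hL3
  calc ((m : ℝ≥0∞) + 1) ^ 2 * ∫⁻ X, (∑' y : {y : Fin (m + 2) → E2 // Function.Injective y ∧ ∀ i, y i ∈ X},
        (annulus ε).indicator 1 (y.1 0 - y.1 1) * pathFun w ε m (Fin.tail y.1)) ∂μ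
      ≤ ((m : ℝ≥0∞) + 1) ^ 2 * (ENNReal.ofReal z ^ (m + 2) *
          (volume (annulus ε) * ((∫⁻ b, w b ∂volume) * volume (annulus ε) ^ m))) := mul_le_mul' le_rfl hL3
    _ = ENNReal.ofReal z * (∫⁻ b, w b ∂volume) * (ENNReal.ofReal z * volume (annulus ε)) *
          (((m : ℝ≥0∞) + 1) ^ 2 * (ENNReal.ofReal z * volume (annulus ε)) ^ m) := by ring

/-- **Expectation of `pathSum₁'`**: `≤ z (∫ w) ∑_m (m+1)² m (z c_ε)^m`. [cite: Richthammer2007, §6.8 (p. 18)] -/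
theorem lintegral_pathSum₁'_le {z : ℝ} (hz : 0 < z) {μ : Measure (PointConfig E2)} (hμ : IsGibbs z μ)
    {w : E2 → ℝ≥0∞} (hw : Measurable w) (ε : ℝ) :
    ∫⁻ X, pathSum₁' w ε X ∂μ ≤ ENNReal.ofReal z * (∫⁻ b, w b ∂volume) *
      ∑' m : ℕ, ((m : ℝ≥0∞) + 1) ^ 2 * (m : ℝ≥0∞) * (ENNReal.ofReal z * volume (annulus ε)) ^ m := by
  unfold pathSum₁'
  rw [lintegral_tsum fun m =>
    ((measurable_tsum_injective (measurable_pathFun hw ε m)).const_mul _).aemeasurable]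
  rw [← ENNReal.tsum_mul_left]
  refine ENNReal.tsum_le_tsum fun m => ?_
  rw [lintegral_const_mul _ (measurable_tsum_injective (measurable_pathFun hw ε m))]
  calc ((m : ℝ≥0∞) + 1) ^ 2 * (m : ℝ≥0∞) * ∫⁻ X, (∑' x : {x : Fin (m + 1) → E2 // Function.Injective x ∧ ∀ i, x i ∈ X},
        pathFun w ε m x.1) ∂μ
      ≤ ((m : ℝ≥0∞) + 1) ^ 2 * (m : ℝ≥0∞) * (ENNReal.ofReal z ^ (m + 1) * ((∫⁻ b, w b ∂volume) * volume (annulus ε) ^ m)) :=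
        mul_le_mul' le_rfl (lintegral_tsum_pathFun_le hz hμ hw ε m)
    _ = ENNReal.ofReal z * (∫⁻ b, w b ∂volume) *
          (((m : ℝ≥0∞) + 1) ^ 2 * (m : ℝ≥0∞) * (ENNReal.ofReal z * volume (annulus ε)) ^ m) := by ring

/-- The series `∑_m (m+1)² m r^m` is finite for `r < 1`. [folklore] -/
theorem tsum_sq_mul_mul_pow_lt_top {r : ℝ≥0∞} (hr : r < 1) :
    ∑' m : ℕ, ((m : ℝ≥0∞) + 1) ^ 2 * (m : ℝ≥0∞) * r ^ m < ⊤ := by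
  have hrtop : r ≠ ⊤ := ne_top_of_lt hr
  set q : ℝ := r.toReal with hq
  have hq0 : 0 ≤ q := ENNReal.toReal_nonneg
  have hq1 : q < 1 := by
    rw [hq, ← ENNReal.toReal_one]
    exact (ENNReal.toReal_lt_toReal hrtop ENNReal.one_ne_top).2 hr
  have hrq : r = ENNReal.ofReal q := by rw [hq, ENNReal.ofReal_toReal hrtop]
  have hnorm : ‖q‖ < 1 := by rw [Real.norm_eq_abs, abs_of_nonneg hq0]; exact hq1
  have hs3 : Summable fun m : ℕ => (m : ℝ) ^ 3 * q ^ m := summable_pow_mul_geometric_of_norm_lt_one 3 hnorm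
  have hs2 : Summable fun m : ℕ => (m : ℝ) ^ 2 * q ^ m := summable_pow_mul_geometric_of_norm_lt_one 2 hnorm
  have hs1 : Summable fun m : ℕ => (m : ℝ) ^ 1 * q ^ m := summable_pow_mul_geometric_of_norm_lt_one 1 hnorm
  have hsum : Summable fun m : ℕ => ((m : ℝ) + 1) ^ 2 * m * q ^ m := by
    have := (hs3.add (hs2.mul_left 2)).add hs1
    refine this.congr fun m => ?_
    ring
  have heq : (fun m : ℕ => ((m : ℝ≥0∞) + 1) ^ 2 * (m : ℝ≥0∞) * r ^ m) =
      fun m : ℕ => ENNReal.ofReal (((m : ℝ) + 1) ^ 2 * m * q ^ m) := by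
    funext m
    rw [ENNReal.ofReal_mul (by positivity), ENNReal.ofReal_mul (by positivity), ENNReal.ofReal_pow hq0,
      ENNReal.ofReal_pow (by positivity), ENNReal.ofReal_add (Nat.cast_nonneg m) zero_le_one,
      ENNReal.ofReal_natCast, ENNReal.ofReal_one, hrq]
  rw [heq, ← ENNReal.ofReal_tsum_of_nonneg (fun m => by positivity) hsum]
  exact ENNReal.ofReal_lt_top

/-- `∑_{j ∈ [m+1], j ≠ 0} c = m c`. [folklore] -/
theorem tsum_fin_succ_ite (m : ℕ) (c : ℝ≥0∞) :
    ∑' j : Fin (m + 1), (if j = 0 then (0 : ℝ≥0∞) else c) = (m : ℝ≥0∞) * c := by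
  rw [tsum_fintype, Fin.sum_univ_succ, if_pos rfl, zero_add]
  simp only [Fin.succ_ne_zero, if_false, Finset.sum_const, Finset.card_univ, Fintype.card_fin, nsmul_eq_mul]

/-- The extended tuple `x', x₀, …, x_m` determines `x'`, `x₀` and `x_m`. [folklore] -/
theorem cons_path_inj_aux {m : ℕ} {a b : E2} {pa pb : Fin (m + 1) → E2}
    (h : (Fin.cons a pa : Fin (m + 2) → E2) = Fin.cons b pb) :
    a = b ∧ pa 0 = pb 0 ∧ pa (Fin.last m) = pb (Fin.last m) := by
  have h0 := congrFun h 0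
  have h1 := congrFun h (Fin.succ 0)
  have hl := congrFun h (Fin.succ (Fin.last m))
  simp only [Fin.cons_zero, Fin.cons_succ] at h0 h1 hl
  exact ⟨h0, h1, hl⟩

/-- **`Σ₃` is dominated by the two path sums** on hard-disc configurations: for the triple
`(x, x', x'')` take a self-avoiding bond path `x = x₀, …, x_m = x''`; if `x'` is not on it,
`x', x₀, …, x_m` is injective with `x' - x₀ ∈ K_ε ∖ K` (hard core), a summand of `pathSum₃`; if
`x' = x_j` (`1 ≤ j ≤ m`), the path is counted at most `m` times, a summand of `pathSum₁'`
("`∑_{x' ∈ X, x' ≠ x_i ∀ i} 1_{K_ε}(x'-x₀) + ∑_{j=1}^m 1_{K_ε}(x_j-x₀)`, the second sum … estimated by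
`m`", §6.8). [cite: Richthammer2007, §6.8 (p. 18)] -/
theorem sigma₃_le_pathSums {τ R ε : ℝ} {n : ℕ} (hτ : 0 ≤ τ) (hRn : R < n) (hε : 0 < ε)
    {X : PointConfig E2} (hX : IsHardCore X) :
    sigma₃ τ R n ε X ≤ ENNReal.ofReal (τ ^ 2 * (1 + ε) ^ 2 / QFun ((n : ℝ) - R) ^ 2) *
      (pathSum₃ (headWeight (R + (1 + ε)) ((n : ℝ) + (1 + ε))) ε X +
        pathSum₁' (headWeight (R + (1 + ε)) ((n : ℝ) + (1 + ε))) ε X) := by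
  classical
  set C : ℝ≥0∞ := ENNReal.ofReal (τ ^ 2 * (1 + ε) ^ 2 / QFun ((n : ℝ) - R) ^ 2) with hC
  set w : E2 → ℝ≥0∞ := headWeight (R + (1 + ε)) ((n : ℝ) + (1 + ε)) with hw
  set I := {t : E2 × E2 × E2 // t.1 ∈ X ∧ t.2.1 ∈ X ∧ t.2.2 ∈ X ∧ t.1 ≠ t.2.1 ∧
      dist t.2.1 t.1 < 1 + ε ∧ epsConnected ε n X t.1 t.2.2} with hI
  -- a self-avoiding path from `x` to `x''` for every triple: length, tuple, properties
  have hpath : ∀ t : I, ∃ (m : ℕ) (p : Fin (m + 1) → E2), Function.Injective p ∧ (∀ i, p i ∈ X) ∧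
      p 0 = t.1.1 ∧ p (Fin.last m) = t.1.2.2 ∧ ∀ i : Fin m, epsBond ε n (p i.castSucc) (p i.succ) :=
    fun t => exists_path_of_epsConnected t.2.1 t.2.2.2.2.2.2
  choose M Pth hPinj hPmem hP0 hPm hPb using hpath
  -- the termwise bound by the weight of the path
  set f : I → ℝ≥0∞ := fun t => ENNReal.ofReal (tDistSq τ R n ε t.1.1 t.1.2.2) with hf
  have hfle : ∀ t : I, f t ≤ C * ((((M t) : ℝ≥0∞) + 1) ^ 2 * pathFun w ε (M t) (Pth t)) := by
    intro t
    have h := ofReal_tDistSq_le_of_path hτ hRn hε hX (hPinj t) (hPmem t) (hPb t)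
    rw [hP0 t, hPm t] at h
    simpa only [hf, hC, hw] using h
  -- split according to whether `x'` lies on the path
  set P : Set I := {t | t.1.2.1 ∈ Set.range (Pth t)} with hP
  have hsplit : sigma₃ τ R n ε X = (∑' t : P, f t) + ∑' t : (Pᶜ : Set I), f t := by
    rw [tsum_subtype P f, tsum_subtype Pᶜ f, ← ENNReal.tsum_add]
    refine tsum_congr fun t => ?_
    rw [Set.indicator_self_add_compl_apply]
  rw [hsplit, mul_add, add_comm]
  refine add_le_add ?_ ?_
  · -- `x'` not on the path: prepend it
    set S₃ := (Σ m : ℕ, {y : Fin (m + 2) → E2 // Function.Injective y ∧ ∀ i, y i ∈ X}) with hS₃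
    have hcons : ∀ t : (Pᶜ : Set I), Function.Injective (Fin.cons t.1.1.2.1 (Pth t.1) : Fin (M t.1 + 2) → E2) ∧
        ∀ i, (Fin.cons t.1.1.2.1 (Pth t.1) : Fin (M t.1 + 2) → E2) i ∈ X := by
      intro t
      constructor
      · exact Fin.cons_injective_iff.2 ⟨t.2, hPinj t.1⟩
      · intro i
        refine Fin.cases ?_ (fun j => ?_) i
        · simpa using t.1.2.2.1
        · simpa using hPmem t.1 j
    set Θ₁ : (Pᶜ : Set I) → S₃ := fun t => ⟨M t.1, Fin.cons t.1.1.2.1 (Pth t.1), hcons t⟩ with hΘ₁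
    -- the extended tuple determines the triple
    set decode₁ : S₃ → E2 × E2 × E2 := fun σ => (σ.2.1 1, σ.2.1 0, σ.2.1 (Fin.last (σ.1 + 1))) with hdecode₁
    have hdec₁ : ∀ t : (Pᶜ : Set I), decode₁ (Θ₁ t) = t.1.1 := by
      intro t
      rw [hdecode₁, hΘ₁]
      dsimp only
      have e1 : (1 : Fin (M t.1 + 2)) = Fin.succ 0 := rfl
      have el : Fin.last (M t.1 + 1) = Fin.succ (Fin.last (M t.1)) := rfl
      rw [e1, el, Fin.cons_succ, Fin.cons_succ, Fin.cons_zero, hP0 t.1, hPm t.1]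
    have hΘ₁inj : Function.Injective Θ₁ := by
      intro a b h
      have h' := congrArg decode₁ h
      rw [hdec₁ a, hdec₁ b] at h'
      exact Subtype.ext (Subtype.ext h')
    set g₁ : S₃ → ℝ≥0∞ := fun σ => C * ((((σ.1 : ℝ≥0∞)) + 1) ^ 2 *
      ((annulus ε).indicator 1 (σ.2.1 0 - σ.2.1 1) * pathFun w ε σ.1 (Fin.tail σ.2.1))) with hg₁
    have hterm : ∀ t : (Pᶜ : Set I), f t ≤ g₁ (Θ₁ t) := by
      intro t
      refine (hfle t.1).trans (le_of_eq ?_)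
      rw [hg₁, hΘ₁]
      simp only [Fin.tail_cons, Fin.cons_zero]
      have e1 : (1 : Fin (M t.1 + 2)) = Fin.succ 0 := rfl
      rw [e1, Fin.cons_succ, hP0 t.1, Set.indicator_of_mem, Pi.one_apply, one_mul]
      -- `x' - x ∈ K_ε ∖ K` by the hard core
      refine ⟨?_, ?_⟩
      · have := hX t.1.1.2.1 t.1.2.2.1 t.1.1.1 t.1.2.1 (Ne.symm t.1.2.2.2.2.1)
        rwa [dist_eq_norm] at this
      · have := t.1.2.2.2.2.2.1
        rwa [dist_eq_norm] at this
    calc ∑' t : (Pᶜ : Set I), f t ≤ ∑' t : (Pᶜ : Set I), g₁ (Θ₁ t) := ENNReal.tsum_le_tsum hterm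
      _ ≤ ∑' σ : S₃, g₁ σ := ENNReal.tsum_comp_le_tsum_of_injective hΘ₁inj g₁
      _ = C * pathSum₃ w ε X := by
          rw [hg₁, ENNReal.tsum_sigma']
          dsimp only
          simp_rw [ENNReal.tsum_mul_left]
          rfl
  · -- `x' = x_j` on the path, `j ≠ 0`
    set S₂ := (Σ m : ℕ, {x : Fin (m + 1) → E2 // Function.Injective x ∧ ∀ i, x i ∈ X} × Fin (m + 1)) with hS₂
    have hidx : ∀ t : P, ∃ j : Fin (M t.1 + 1), Pth t.1 j = t.1.1.2.1 := fun t => t.2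
    choose J hJ using hidx
    have hJne : ∀ t : P, J t ≠ 0 := by
      intro t h
      have := hJ t
      rw [h, hP0 t.1] at this
      exact t.1.2.2.2.2.1 this
    set Θ₂ : P → S₂ := fun t => ⟨M t.1, (⟨Pth t.1, hPinj t.1, hPmem t.1⟩, J t)⟩ with hΘ₂
    set decode₂ : S₂ → E2 × E2 × E2 := fun σ => (σ.2.1.1 0, σ.2.1.1 σ.2.2, σ.2.1.1 (Fin.last σ.1)) with hdecode₂
    have hdec₂ : ∀ t : P, decode₂ (Θ₂ t) = t.1.1 := by
      intro t
      rw [hdecode₂, hΘ₂]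
      dsimp only
      rw [hP0 t.1, hJ t, hPm t.1]
    have hΘ₂inj : Function.Injective Θ₂ := by
      intro a b h
      have h' := congrArg decode₂ h
      rw [hdec₂ a, hdec₂ b] at h'
      exact Subtype.ext (Subtype.ext h')
    set g₂ : S₂ → ℝ≥0∞ := fun σ => if σ.2.2 = 0 then 0 else
      C * ((((σ.1 : ℝ≥0∞)) + 1) ^ 2 * pathFun w ε σ.1 σ.2.1.1) with hg₂
    have hterm : ∀ t : P, f t ≤ g₂ (Θ₂ t) := by
      intro t
      show f t.1 ≤ ite (J t = 0) 0 (C * ((((M t.1 : ℕ) : ℝ≥0∞) + 1) ^ 2 * pathFun w ε (M t.1) (Pth t.1)))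
      rw [if_neg (hJne t)]
      exact hfle t.1
    calc ∑' t : P, f t ≤ ∑' t : P, g₂ (Θ₂ t) := ENNReal.tsum_le_tsum hterm
      _ ≤ ∑' σ : S₂, g₂ σ := ENNReal.tsum_comp_le_tsum_of_injective hΘ₂inj g₂
      _ = C * pathSum₁' w ε X := by
          rw [hg₂, ENNReal.tsum_sigma']
          dsimp only
          simp_rw [ENNReal.tsum_prod', tsum_fin_succ_ite]
          unfold pathSum₁'
          rw [← ENNReal.tsum_mul_left]
          refine tsum_congr fun m => ?_
          rw [← ENNReal.tsum_mul_left, ← ENNReal.tsum_mul_left]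
          refine tsum_congr fun x => ?_
          ring

/-- **Expectation of `Σ₃`** (Richthammer 2007, §6.8):
`∫ μ(dX) Σ₃ ≤ (τ²c_K²/Q(n-R)²) z (∫_{Λ_n̄} q(|x|-R̄)²) [z c_ε ∑(m+1)²(zc_ε)^m + ∑(m+1)² m (zc_ε)^m]`.
[cite: Richthammer2007, §6.8 (p. 18)] -/
theorem lintegral_sigma₃_le {z : ℝ} (hz : 0 < z) {μ : Measure (PointConfig E2)} (hμ : IsGibbs z μ)
    {τ R ε : ℝ} {n : ℕ} (hτ : 0 ≤ τ) (hRn : R < n) (hε : 0 < ε) :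
    ∫⁻ X, sigma₃ τ R n ε X ∂μ ≤ ENNReal.ofReal (τ ^ 2 * (1 + ε) ^ 2 / QFun ((n : ℝ) - R) ^ 2) *
      (ENNReal.ofReal z * (∫⁻ x in box ((n : ℝ) + (1 + ε)), ENNReal.ofReal (qFun (supNorm x - (R + (1 + ε))) ^ 2) ∂volume) *
        ((ENNReal.ofReal z * volume (annulus ε)) * ∑' m : ℕ, ((m : ℝ≥0∞) + 1) ^ 2 * (ENNReal.ofReal z * volume (annulus ε)) ^ m +
          ∑' m : ℕ, ((m : ℝ≥0∞) + 1) ^ 2 * (m : ℝ≥0∞) * (ENNReal.ofReal z * volume (annulus ε)) ^ m)) := by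
  have hw := measurable_headWeight (R + (1 + ε)) ((n : ℝ) + (1 + ε))
  calc ∫⁻ X, sigma₃ τ R n ε X ∂μ
      ≤ ∫⁻ X, ENNReal.ofReal (τ ^ 2 * (1 + ε) ^ 2 / QFun ((n : ℝ) - R) ^ 2) *
          (pathSum₃ (headWeight (R + (1 + ε)) ((n : ℝ) + (1 + ε))) ε X +
            pathSum₁' (headWeight (R + (1 + ε)) ((n : ℝ) + (1 + ε))) ε X) ∂μ := by
        refine lintegral_mono_ae ?_
        filter_upwards [hμ.ae_isHardCore] with X hX
        exact sigma₃_le_pathSums hτ hRn hε hX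
    _ = ENNReal.ofReal (τ ^ 2 * (1 + ε) ^ 2 / QFun ((n : ℝ) - R) ^ 2) *
          (∫⁻ X, pathSum₃ (headWeight (R + (1 + ε)) ((n : ℝ) + (1 + ε))) ε X ∂μ +
            ∫⁻ X, pathSum₁' (headWeight (R + (1 + ε)) ((n : ℝ) + (1 + ε))) ε X ∂μ) := by
        have hm : Measurable fun X => pathSum₃ (headWeight (R + (1 + ε)) ((n : ℝ) + (1 + ε))) ε X +
            pathSum₁' (headWeight (R + (1 + ε)) ((n : ℝ) + (1 + ε))) ε X :=
          (measurable_pathSum₃ hw ε).add (measurable_pathSum₁' hw ε)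
        rw [lintegral_const_mul _ hm, lintegral_add_left (measurable_pathSum₃ hw ε)]
    _ ≤ _ := by
        refine mul_le_mul' le_rfl ?_
        rw [← lintegral_headWeight]
        calc ∫⁻ X, pathSum₃ (headWeight (R + (1 + ε)) ((n : ℝ) + (1 + ε))) ε X ∂μ +
              ∫⁻ X, pathSum₁' (headWeight (R + (1 + ε)) ((n : ℝ) + (1 + ε))) ε X ∂μ
            ≤ ENNReal.ofReal z * (∫⁻ b, headWeight (R + (1 + ε)) ((n : ℝ) + (1 + ε)) b ∂volume) *
                (ENNReal.ofReal z * volume (annulus ε)) *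
                ∑' m : ℕ, ((m : ℝ≥0∞) + 1) ^ 2 * (ENNReal.ofReal z * volume (annulus ε)) ^ m +
              ENNReal.ofReal z * (∫⁻ b, headWeight (R + (1 + ε)) ((n : ℝ) + (1 + ε)) b ∂volume) *
                ∑' m : ℕ, ((m : ℝ≥0∞) + 1) ^ 2 * (m : ℝ≥0∞) * (ENNReal.ofReal z * volume (annulus ε)) ^ m :=
              add_le_add (lintegral_pathSum₃_le hz hμ hw ε) (lintegral_pathSum₁'_le hz hμ hw ε)
          _ = _ := by ring

/-! ### The expectations tend to zero (the limit part of Lemma 13) -/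

/-- **`∫ μ(dX) Σ₁(n, X) → 0`** as `n → ∞` (for `z c_ε < 1`). [cite: Richthammer2007, §6.8 (p. 18)] -/
theorem tendsto_lintegral_sigma₁ {z : ℝ} (hz : 0 < z) {μ : Measure (PointConfig E2)} (hμ : IsGibbs z μ)
    {τ R ε : ℝ} (hτ : 0 ≤ τ) (hε : 0 < ε)
    (hsmall : ENNReal.ofReal z * volume (Metric.ball (0 : E2) (1 + ε) \ Metric.closedBall 0 1) < 1) :
    Tendsto (fun n : ℕ => ∫⁻ X, sigma₁ τ R n ε X ∂μ) atTop (𝓝 0) := by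
  rw [← annulus_eq] at hsmall
  set K : ℝ≥0∞ := ENNReal.ofReal (τ ^ 2 * (1 + ε) ^ 2) *
    (ENNReal.ofReal z * ∑' m : ℕ, ((m : ℝ≥0∞) + 1) ^ 2 * (ENNReal.ofReal z * volume (annulus ε)) ^ m) with hK
  have hKtop : K ≠ ⊤ := by
    rw [hK]
    exact ENNReal.mul_ne_top ENNReal.ofReal_ne_top
      (ENNReal.mul_ne_top ENNReal.ofReal_ne_top (tsum_sq_mul_pow_lt_top hsmall).ne)
  have hc : Tendsto (fun n : ℕ => cFun (R + (1 + ε)) ((n : ℝ) + (1 + ε))) atTop (𝓝 0) :=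
    (tendsto_cFun_zero (R + (1 + ε))).comp (tendsto_atTop_add_const_right _ _ tendsto_natCast_atTop_atTop)
  have hKc : Tendsto (fun n : ℕ => K * cFun (R + (1 + ε)) ((n : ℝ) + (1 + ε))) atTop (𝓝 0) := by
    have := ENNReal.Tendsto.const_mul hc (Or.inr hKtop)
    simpa using this
  refine tendsto_of_tendsto_of_tendsto_of_le_of_le' tendsto_const_nhds hKc (Eventually.of_forall fun n => zero_le) ?_
  filter_upwards [eventually_gt_atTop ⌈R⌉₊] with n hn
  have hRn : R < n := lt_of_le_of_lt (Nat.le_ceil R) (by exact_mod_cast hn)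
  calc ∫⁻ X, sigma₁ τ R n ε X ∂μ ≤ _ := lintegral_sigma₁_le hz hμ hτ hRn hε
    _ = K * cFun (R + (1 + ε)) ((n : ℝ) + (1 + ε)) := by
        unfold cFun
        have e : (n : ℝ) + (1 + ε) - (R + (1 + ε)) = (n : ℝ) - R := by ring
        rw [e, div_eq_mul_one_div (τ ^ 2 * (1 + ε) ^ 2), ENNReal.ofReal_mul (by positivity), hK]
        ring

/-- **`Q(n-R)⁻² ∫ μ(dX) Σ₂(n, X) → 0`** as `n → ∞` (for `z c_ε < 1`). [cite: Richthammer2007, §6.8 (p. 18)] -/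
theorem tendsto_lintegral_sigma₂ {z : ℝ} (hz : 0 < z) {μ : Measure (PointConfig E2)} (hμ : IsGibbs z μ)
    (R : ℝ) {ε : ℝ} (hε : 0 < ε)
    (hsmall : ENNReal.ofReal z * volume (Metric.ball (0 : E2) (1 + ε) \ Metric.closedBall 0 1) < 1) :
    Tendsto (fun n : ℕ => ENNReal.ofReal (1 / QFun ((n : ℝ) - R) ^ 2) * ∫⁻ X, sigma₂ R n X ∂μ) atTop (𝓝 0) := by
  rw [← annulus_eq] at hsmall
  set K : ℝ≥0∞ := ENNReal.ofReal z * ∑' m : ℕ, ((m : ℝ≥0∞) + 1) ^ 2 * (ENNReal.ofReal z * volume (annulus ε)) ^ m with hK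
  have hKtop : K ≠ ⊤ := ENNReal.mul_ne_top ENNReal.ofReal_ne_top (tsum_sq_mul_pow_lt_top hsmall).ne
  have hc : Tendsto (fun n : ℕ => cFun (R + (1 + ε)) ((n : ℝ) + (1 + ε))) atTop (𝓝 0) :=
    (tendsto_cFun_zero (R + (1 + ε))).comp (tendsto_atTop_add_const_right _ _ tendsto_natCast_atTop_atTop)
  have hKc : Tendsto (fun n : ℕ => K * cFun (R + (1 + ε)) ((n : ℝ) + (1 + ε))) atTop (𝓝 0) := by
    have := ENNReal.Tendsto.const_mul hc (Or.inr hKtop)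
    simpa using this
  refine tendsto_of_tendsto_of_tendsto_of_le_of_le' tendsto_const_nhds hKc (Eventually.of_forall fun n => zero_le) ?_
  filter_upwards [] with n
  calc ENNReal.ofReal (1 / QFun ((n : ℝ) - R) ^ 2) * ∫⁻ X, sigma₂ R n X ∂μ
      ≤ ENNReal.ofReal (1 / QFun ((n : ℝ) - R) ^ 2) * _ := mul_le_mul' le_rfl (lintegral_sigma₂_le hz hμ R hε.le n)
    _ = K * cFun (R + (1 + ε)) ((n : ℝ) + (1 + ε)) := by
        unfold cFun
        have e : (n : ℝ) + (1 + ε) - (R + (1 + ε)) = (n : ℝ) - R := by ring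
        rw [e, hK]
        ring

/-- **`∫ μ(dX) Σ₃(n, X) → 0`** as `n → ∞` (for `z c_ε < 1`). [cite: Richthammer2007, §6.8 (p. 18)] -/
theorem tendsto_lintegral_sigma₃ {z : ℝ} (hz : 0 < z) {μ : Measure (PointConfig E2)} (hμ : IsGibbs z μ)
    {τ R ε : ℝ} (hτ : 0 ≤ τ) (hε : 0 < ε)
    (hsmall : ENNReal.ofReal z * volume (Metric.ball (0 : E2) (1 + ε) \ Metric.closedBall 0 1) < 1) :
    Tendsto (fun n : ℕ => ∫⁻ X, sigma₃ τ R n ε X ∂μ) atTop (𝓝 0) := by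
  rw [← annulus_eq] at hsmall
  set K : ℝ≥0∞ := ENNReal.ofReal (τ ^ 2 * (1 + ε) ^ 2) * (ENNReal.ofReal z *
    ((ENNReal.ofReal z * volume (annulus ε)) * ∑' m : ℕ, ((m : ℝ≥0∞) + 1) ^ 2 * (ENNReal.ofReal z * volume (annulus ε)) ^ m +
      ∑' m : ℕ, ((m : ℝ≥0∞) + 1) ^ 2 * (m : ℝ≥0∞) * (ENNReal.ofReal z * volume (annulus ε)) ^ m)) with hK
  have hKtop : K ≠ ⊤ := by
    rw [hK]
    refine ENNReal.mul_ne_top ENNReal.ofReal_ne_top (ENNReal.mul_ne_top ENNReal.ofReal_ne_top ?_)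
    refine ENNReal.add_ne_top.2 ⟨ENNReal.mul_ne_top ?_ (tsum_sq_mul_pow_lt_top hsmall).ne,
      (tsum_sq_mul_mul_pow_lt_top hsmall).ne⟩
    have hvol : volume (annulus ε) < ⊤ :=
      lt_of_le_of_lt (measure_mono (by rw [annulus_eq]; exact Set.sdiff_subset)) measure_ball_lt_top
    exact ENNReal.mul_ne_top ENNReal.ofReal_ne_top hvol.ne
  have hc : Tendsto (fun n : ℕ => cFun (R + (1 + ε)) ((n : ℝ) + (1 + ε))) atTop (𝓝 0) :=
    (tendsto_cFun_zero (R + (1 + ε))).comp (tendsto_atTop_add_const_right _ _ tendsto_natCast_atTop_atTop)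
  have hKc : Tendsto (fun n : ℕ => K * cFun (R + (1 + ε)) ((n : ℝ) + (1 + ε))) atTop (𝓝 0) := by
    have := ENNReal.Tendsto.const_mul hc (Or.inr hKtop)
    simpa using this
  refine tendsto_of_tendsto_of_tendsto_of_le_of_le' tendsto_const_nhds hKc (Eventually.of_forall fun n => zero_le) ?_
  filter_upwards [eventually_gt_atTop ⌈R⌉₊] with n hn
  have hRn : R < n := lt_of_le_of_lt (Nat.le_ceil R) (by exact_mod_cast hn)
  calc ∫⁻ X, sigma₃ τ R n ε X ∂μ ≤ _ := lintegral_sigma₃_le hz hμ hτ hRn hε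
    _ = K * cFun (R + (1 + ε)) ((n : ℝ) + (1 + ε)) := by
        unfold cFun
        have e : (n : ℝ) + (1 + ε) - (R + (1 + ε)) = (n : ℝ) - R := by ring
        rw [e, div_eq_mul_one_div (τ ^ 2 * (1 + ε) ^ 2), ENNReal.ofReal_mul (by positivity), hK]
        ring

end Literature.Barriers.AtomisticToContinuum.HardDisk

end
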